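import Summits.QuantumFields.YangMills.Theses.ConvexGribovBody
import Summits.QuantumFields.YangMills.Theorems.ConvexGribovBodyNonSimplyConnectedLatticeGapStubSectorIdentity
import Summits.QuantumFields.YangMills.Theorems.ConvexGribovBodyNonSimplyConnectedLatticeGapStubSectorMixtureAux3
import Summits.QuantumFields.YangMills.Theorems.FradkinShenkerFlowFiniteSusceptibilityWeakCouplingAxisIsotropy
import Literature.MathematicalPhysics.QuantumFieldTheory.WilsonAxisSymmetry
import Literature.MathematicalPhysics.QuantumFieldTheory.LatticeGaugeProofs
import HarnessLib

/-!
# Crux `NonSimplyConnectedLatticeGap` (stmt-QuantumFields-16405), route `ConvexGribovBody`,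
# line `twist-equipartition-blindness` — stub `stub_sectorMixture` (MIX)

The BOOKKEEPING step of the line: for the `(H, r∘π)` Wilson theory of the universal cover
`π : H →* G` on the symmetric tori `(2S+1)⁴`, and ANY interface labelling family
`cls S : GaugeConfig 4 (2S+1) H → Option (planes → ker π)` of configurations by 't Hooft flux sectors,
small bad event + per-sector clustering + ELECTRIC twist equipartition + ELECTRIC blindness at `β`
imply the volume-uniform clustering body at `β` on pulled-back local observables:

* `mix_core` — the statement over a generic finite label alphabet `Z` and a continuous
  representation `ρ` of `H`, using only the interface clauses X_m (measurable fibres), X6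
  (translation invariance) and X5 (axis exchange): per torus, full blindness for `A` and `B`
  (`mix_blind_at`, layer 3) and the mixture bound (`mix_cov_at`, layer 3, over the landed law of
  total covariance `stub_sectorIdentity`) give
  `|Cov_S(Ã, B̃_n)| ≤ |C_{AB}| e^{−mn} + ½ C_A C_B e^{−2μ(2S+1)} + 6 M_A M_B |C_bad| e^{−cS}`, and the time
  bound `n ≤ S` (Disproof §A1, used exactly here through `mix_rate_bounds`, layer 1) turns this into
  `C e^{−m'n}` with `m' = min m (min 2μ c)`, `S₁ = 0`;
* `stub_sectorMixture` — the registered stub verbatim, by `mix_core` at `Z = ker π` (finite),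
  `ρ = r.ρ ∘ π`.
-/

set_option autoImplicit false

noncomputable section

open MeasureTheory
open Literature.MathematicalPhysics.QuantumFieldTheory Literature.MathematicalPhysics.QuantumLattice
open Summit.QuantumFields.YangMills.Theorems.FiniteSusceptibilityWeakCoupling.AxisIsotropy
  (permSpecies permSpecies_F)

namespace Summit.QuantumFields.YangMills.Theorems.NonSimplyConnectedLatticeGap

/-- **MIX, core form.** For a continuous `π : H →* G`, a continuous representation `ρ` of `H` (the
centre-blind `r ∘ π` in the application), a finite label alphabet `Z` (the kernel of `π`) and a
labelling family `cls S` of the tori `(2S+1)⁴` with measurable fibres (X_m), translation invariance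
(X6) and axis exchange (X5): small bad event + per-sector clustering + electric equipartition +
electric blindness at `β` give volume-uniform clustering of pulled-back local observables at `β`,
with rate `m' = min m (min 2μ c)` and `S₁ = 0` — the time bound `n ≤ S` converts the bad-event term
`e^{−cS}` and the blindness term `e^{−2μ(2S+1)}` into `e^{−m'n}` (`mix_rate_bounds`). -/
theorem mix_core : ∀ {G H : Type} [Group G] [MeasurableSpace G] [TopologicalSpace G] [BorelSpace G] [Group H]
    [TopologicalSpace H] [IsTopologicalGroup H] [CompactSpace H] [MeasurableSpace H] [BorelSpace H]
    (π : H →* G), Continuous π → ∀ {N : ℕ} (ρ : H →* Matrix (Fin N) (Fin N) ℂ), Continuous ρ → ∀ (β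
    : ℝ) {Z : Type} [Fintype Z] (cls : ∀ S : ℕ,
    Literature.MathematicalPhysics.QuantumFieldTheory.GaugeConfig 4 (2 * S + 1) H → Option ({p : Fin
    4 × Fin 4 // p.1 < p.2} → Z)) (ν : ∀ S : ℕ, MeasureTheory.Measure
    (Literature.MathematicalPhysics.QuantumFieldTheory.GaugeConfig 4 (2 * S + 1) H)), (∀ S : ℕ, ν S
    = Literature.MathematicalPhysics.QuantumFieldTheory.wilsonMeasure ρ β) → (∀ (S : ℕ) (o : Option
    ({p : Fin 4 × Fin 4 // p.1 < p.2} → Z)), MeasurableSet ((cls S) ⁻¹' {o})) → (∀ (S : ℕ) (v :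
    Literature.MathematicalPhysics.QuantumFieldTheory.Site 4 (2 * S + 1)) (V :
    Literature.MathematicalPhysics.QuantumFieldTheory.GaugeConfig 4 (2 * S + 1) H), (cls S) (fun e
    => V (e.1 + v, e.2)) = (cls S) V) → (∀ (S : ℕ) (q : {p : Fin 4 × Fin 4 // p.1 < p.2}), q.1.1 ≠ 0
    → ∃ (σ : Equiv.Perm (Fin 4)) (Ψ : ({p : Fin 4 × Fin 4 // p.1 < p.2} → Z) → ({p : Fin 4 × Fin 4
    // p.1 < p.2} → Z)), Function.Injective Ψ ∧ (∀ V :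
    Literature.MathematicalPhysics.QuantumFieldTheory.GaugeConfig 4 (2 * S + 1) H, (cls S)
    (Literature.MathematicalPhysics.QuantumFieldTheory.configPerm σ V) = ((cls S) V).map Ψ) ∧ (∀ z w
    : {p : Fin 4 × Fin 4 // p.1 < p.2} → Z, (∀ q' : {p : Fin 4 × Fin 4 // p.1 < p.2}, q' ≠ q → z q'
    = w q') → ∀ q'' : {p : Fin 4 × Fin 4 // p.1 < p.2}, q''.1.1 ≠ 0 → Ψ z q'' = Ψ w q'')) → (∃ c :
    ℝ, 0 < c ∧ ∃ C : ℝ, ∀ S : ℕ, (ν S ((cls S) ⁻¹' {none})).toReal ≤ C * Real.exp (-(c * S))) → (∃ m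
    : ℝ, 0 < m ∧ ∀ A B : Literature.MathematicalPhysics.QuantumFieldTheory.YMSpecies G, ∃ C : ℝ, ∀
    (S n : ℕ) (z : {p : Fin 4 × Fin 4 // p.1 < p.2} → Z), n ≤ S → |(∫ V in ((cls S) ⁻¹' {some z}),
    A.F (fun e => π (Literature.MathematicalPhysics.QuantumLattice.torusLift (2 * S + 1) V e)) * B.F
    (fun e => π (Literature.MathematicalPhysics.QuantumLattice.configShift (-Pi.single 0 (n : ℤ))
    (Literature.MathematicalPhysics.QuantumLattice.torusLift (2 * S + 1) V) e)) ∂ν S) - ((ν S ((cls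
    S) ⁻¹' {some z})).toReal)⁻¹ * (∫ V in ((cls S) ⁻¹' {some z}), A.F (fun e => π
    (Literature.MathematicalPhysics.QuantumLattice.torusLift (2 * S + 1) V e)) ∂ν S) * (∫ V in ((cls
    S) ⁻¹' {some z}), B.F (fun e => π (Literature.MathematicalPhysics.QuantumLattice.configShift
    (-Pi.single 0 (n : ℤ)) (Literature.MathematicalPhysics.QuantumLattice.torusLift (2 * S + 1) V)
    e)) ∂ν S)| ≤ C * Real.exp (-(m * n)) * (ν S ((cls S) ⁻¹' {some z})).toReal) → (∃ μ : ℝ, 0 < μ ∧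
    ∃ C : ℝ, ∀ (S : ℕ) (z w : {p : Fin 4 × Fin 4 // p.1 < p.2} → Z), (∀ q : {p : Fin 4 × Fin 4 //
    p.1 < p.2}, q.1.1 ≠ 0 → z q = w q) → |(ν S ((cls S) ⁻¹' {some z})).toReal - (ν S ((cls S) ⁻¹'
    {some w})).toReal| ≤ C * Real.exp (-(μ * (2 * (S : ℝ) + 1))) * (ν S ((cls S) ⁻¹' {some
    w})).toReal) → (∃ μ : ℝ, 0 < μ ∧ ∀ A :
    Literature.MathematicalPhysics.QuantumFieldTheory.YMSpecies G, ∃ C : ℝ, ∀ (S : ℕ) (z w : {p :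
    Fin 4 × Fin 4 // p.1 < p.2} → Z), (∀ q : {p : Fin 4 × Fin 4 // p.1 < p.2}, q.1.1 ≠ 0 → z q = w
    q) → |(ν S ((cls S) ⁻¹' {some w})).toReal * (∫ V in ((cls S) ⁻¹' {some z}), A.F (fun e => π
    (Literature.MathematicalPhysics.QuantumLattice.torusLift (2 * S + 1) V e)) ∂ν S) - (ν S ((cls S)
    ⁻¹' {some z})).toReal * (∫ V in ((cls S) ⁻¹' {some w}), A.F (fun e => π
    (Literature.MathematicalPhysics.QuantumLattice.torusLift (2 * S + 1) V e)) ∂ν S)| ≤ C * Real.exp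
    (-(μ * (2 * (S : ℝ) + 1))) * (ν S ((cls S) ⁻¹' {some z})).toReal * (ν S ((cls S) ⁻¹' {some
    w})).toReal) → ∃ m : ℝ, 0 < m ∧ ∃ S₁ : ℕ, ∀ A B :
    Literature.MathematicalPhysics.QuantumFieldTheory.YMSpecies G, ∃ C : ℝ, ∀ S n : ℕ, S₁ ≤ S → n ≤
    S → |Literature.MathematicalPhysics.QuantumFieldTheory.latticeConnectedCorr ρ β (2 * S + 1) (fun
    V => A.F (fun e => π (V e))) (fun V => B.F (fun e => π (V e))) n| ≤ C * Real.exp (-(m * n)) := by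
  intro G H _ _ _ _ _ _ _ _ _ _ π hπc N ρ hρ β Z _ cls ν hν hXm hX6 hX5 hbad hpsc hequi heblind
  obtain rfl : ν = fun S => wilsonMeasure ρ β := funext hν
  beta_reduce at hbad hpsc hequi heblind
  obtain ⟨c, hc, Cbad, hCbad⟩ := hbad
  obtain ⟨m, hm, hPSC⟩ := hpsc
  obtain ⟨μ₁, -, C₁, hC₁⟩ := hequi
  obtain ⟨μ₂, hμ₂, hEB⟩ := heblind
  choose Cpsc hCpsc using hPSC
  choose C₂ hC₂ using hEB
  refine ⟨min m (min (2 * μ₂) c), lt_min hm (lt_min (by linarith) hc), 0, fun A B => ?_⟩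
  obtain ⟨MA, hMA⟩ := A.bounded
  obtain ⟨MB, hMB⟩ := B.bounded
  have hMA0 : 0 ≤ MA := (abs_nonneg _).trans (hMA fun _ => 1)
  have hMB0 : 0 ≤ MB := (abs_nonneg _).trans (hMB fun _ => 1)
  refine ⟨|Cpsc A B| + (1 / 2) * ((4 * (|C₂ A| + ∑ τ : Equiv.Perm (Fin 4), |C₂ (permSpecies τ A)|)) *
      (4 * (|C₂ B| + ∑ τ : Equiv.Perm (Fin 4), |C₂ (permSpecies τ B)|))) + 6 * (MA * MB * |Cbad|),
    fun S n _ hn => ?_⟩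
  haveI := isProbabilityMeasure_wilsonMeasure (d := 4) (L := 2 * S + 1) ρ hρ β
  have hcA0 : 0 ≤ 4 * (|C₂ A| + ∑ τ : Equiv.Perm (Fin 4), |C₂ (permSpecies τ A)|) := by positivity
  have hcB0 : 0 ≤ 4 * (|C₂ B| + ∑ τ : Equiv.Perm (Fin 4), |C₂ (permSpecies τ B)|) := by positivity
  -- full blindness on this torus, for `A` and for `B`
  have hblA := mix_blind_at π ρ hρ β (cls S) (hXm S) (hX5 S) A C₁
    (Real.exp (-(μ₁ * (2 * (S : ℝ) + 1)))) (Real.exp (-(μ₂ * (2 * (S : ℝ) + 1)))) (Real.exp_nonneg _)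
    C₂ (fun z => ((wilsonMeasure ρ β : MeasureTheory.Measure (GaugeConfig 4 (2 * S + 1) H))
      ((cls S) ⁻¹' {some z})).toReal)
    (fun B' z => ∫ V in (cls S) ⁻¹' {some z}, B'.F (fun e => π (torusLift (2 * S + 1) V e))
      ∂(wilsonMeasure ρ β : MeasureTheory.Measure (GaugeConfig 4 (2 * S + 1) H)))
    (fun _ => rfl) (fun _ _ => rfl) (hC₁ S) (fun B' z w h => hC₂ B' S z w h)
  have hblB := mix_blind_at π ρ hρ β (cls S) (hXm S) (hX5 S) B C₁
    (Real.exp (-(μ₁ * (2 * (S : ℝ) + 1)))) (Real.exp (-(μ₂ * (2 * (S : ℝ) + 1)))) (Real.exp_nonneg _)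
    C₂ (fun z => ((wilsonMeasure ρ β : MeasureTheory.Measure (GaugeConfig 4 (2 * S + 1) H))
      ((cls S) ⁻¹' {some z})).toReal)
    (fun B' z => ∫ V in (cls S) ⁻¹' {some z}, B'.F (fun e => π (torusLift (2 * S + 1) V e))
      ∂(wilsonMeasure ρ β : MeasureTheory.Measure (GaugeConfig 4 (2 * S + 1) H)))
    (fun _ => rfl) (fun _ _ => rfl) (hC₁ S) (fun B' z w h => hC₂ B' S z w h)
  -- the mixture bound on this torus
  have hcov := mix_cov_at π hπc ρ hρ β _ rfl (cls S) (hXm S) (hX6 S) A B MA MB hMA hMB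
    (-Pi.single 0 (n : ℤ)) (|Cpsc A B| * Real.exp (-(m * n)))
    (4 * (|C₂ A| + ∑ τ : Equiv.Perm (Fin 4), |C₂ (permSpecies τ A)|) *
      Real.exp (-(μ₂ * (2 * (S : ℝ) + 1))))
    (4 * (|C₂ B| + ∑ τ : Equiv.Perm (Fin 4), |C₂ (permSpecies τ B)|) *
      Real.exp (-(μ₂ * (2 * (S : ℝ) + 1))))
    (by positivity) (mul_nonneg hcA0 (Real.exp_nonneg _)) (mul_nonneg hcB0 (Real.exp_nonneg _))
    (fun z => (hCpsc A B S n z hn).trans (mul_le_mul_of_nonneg_right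
      (mul_le_mul_of_nonneg_right (le_abs_self _) (Real.exp_nonneg _)) ENNReal.toReal_nonneg))
    hblA hblB
  obtain ⟨r1, r2, r3⟩ := mix_rate_bounds m μ₂ c hμ₂ hc S n hn
  have hpn : ((wilsonMeasure ρ β : MeasureTheory.Measure (GaugeConfig 4 (2 * S + 1) H))
      ((cls S) ⁻¹' {none})).toReal ≤ |Cbad| * Real.exp (-(min m (min (2 * μ₂) c) * n)) :=
    (hCbad S).trans ((mul_le_mul_of_nonneg_right (le_abs_self _) (Real.exp_nonneg _)).trans
      (mul_le_mul_of_nonneg_left r3 (abs_nonneg _)))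
  unfold latticeConnectedCorr
  refine hcov.trans ?_
  have t1 : |Cpsc A B| * Real.exp (-(m * n)) ≤ |Cpsc A B| * Real.exp (-(min m (min (2 * μ₂) c) * n)) :=
    mul_le_mul_of_nonneg_left r1 (abs_nonneg _)
  have t2 : (4 * (|C₂ A| + ∑ τ : Equiv.Perm (Fin 4), |C₂ (permSpecies τ A)|) *
      Real.exp (-(μ₂ * (2 * (S : ℝ) + 1)))) *
      (4 * (|C₂ B| + ∑ τ : Equiv.Perm (Fin 4), |C₂ (permSpecies τ B)|) *
      Real.exp (-(μ₂ * (2 * (S : ℝ) + 1)))) ≤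
      (4 * (|C₂ A| + ∑ τ : Equiv.Perm (Fin 4), |C₂ (permSpecies τ A)|)) *
      (4 * (|C₂ B| + ∑ τ : Equiv.Perm (Fin 4), |C₂ (permSpecies τ B)|)) *
      Real.exp (-(min m (min (2 * μ₂) c) * n)) := by
    calc _ = (4 * (|C₂ A| + ∑ τ : Equiv.Perm (Fin 4), |C₂ (permSpecies τ A)|)) *
          (4 * (|C₂ B| + ∑ τ : Equiv.Perm (Fin 4), |C₂ (permSpecies τ B)|)) *
          (Real.exp (-(μ₂ * (2 * (S : ℝ) + 1))) * Real.exp (-(μ₂ * (2 * (S : ℝ) + 1)))) := by ring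
      _ ≤ _ := mul_le_mul_of_nonneg_left r2 (mul_nonneg hcA0 hcB0)
  have t3 : MA * MB * ((wilsonMeasure ρ β : MeasureTheory.Measure (GaugeConfig 4 (2 * S + 1) H))
      ((cls S) ⁻¹' {none})).toReal ≤
      MA * MB * |Cbad| * Real.exp (-(min m (min (2 * μ₂) c) * n)) := by
    calc _ ≤ MA * MB * (|Cbad| * Real.exp (-(min m (min (2 * μ₂) c) * n))) :=
          mul_le_mul_of_nonneg_left hpn (mul_nonneg hMA0 hMB0)
      _ = _ := by ring
  calc _ ≤ |Cpsc A B| * Real.exp (-(min m (min (2 * μ₂) c) * n)) +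
        (1 / 2) * ((4 * (|C₂ A| + ∑ τ : Equiv.Perm (Fin 4), |C₂ (permSpecies τ A)|)) *
          (4 * (|C₂ B| + ∑ τ : Equiv.Perm (Fin 4), |C₂ (permSpecies τ B)|)) *
          Real.exp (-(min m (min (2 * μ₂) c) * n))) +
        6 * (MA * MB * |Cbad| * Real.exp (-(min m (min (2 * μ₂) c) * n))) :=
        add_le_add (add_le_add t1 (mul_le_mul_of_nonneg_left t2 (by norm_num)))
          (mul_le_mul_of_nonneg_left t3 (by norm_num))
    _ = _ := by ring


/-- **STUB MIX — sector mixture on the symmetric torus (line `twist-equipartition-blindness` of crux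
`NonSimplyConnectedLatticeGap`, stmt-QuantumFields-16405).** For ANY labelling family satisfying the
interface: small bad event + per-sector clustering + ELECTRIC twist equipartition + ELECTRIC
blindness ⇒ the volume-uniform clustering body for the `(H, r∘π)` theory on pulled-back observables.
Proof: `mix_core` with `Z = ker π` (finite), reading off the interface clauses X_m (measurable
fibres), X6 (translation invariance) and X5 (axis exchange); (II) axis exchange makes every
magnetic slot electric (`mix_blind_at`), (I) the law of total covariance `stub_sectorIdentity`
(`mix_cov_at`), bounded by `C_{A,B}(e^{−mn} + e^{−2μ(2S+1)} + e^{−cS}) ≤ C' e^{−m'n}` with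
`m' = min(m, 2μ, c)` BECAUSE `n ≤ S` (Disproof §A1). -/
theorem stub_sectorMixture : ∀ (G : Type) [Group G] [TopologicalSpace G] [IsTopologicalGroup G] [CompactSpace G] [MeasurableSpace G] [BorelSpace
    G], Literature.MathematicalPhysics.QuantumFieldTheory.IsCompactSimpleLieGroup G → ∀ (H : Type) [Group H]
    [TopologicalSpace H] [IsTopologicalGroup H] [CompactSpace H] [MeasurableSpace H] [BorelSpace H],
    Literature.MathematicalPhysics.QuantumFieldTheory.IsCompactSimpleLieGroup H → SimplyConnectedSpace H → ∀ (π : H →*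
    G), Continuous π → Function.Surjective π → π.ker ≤ Subgroup.center H → (π.ker : Set H).Finite → π.ker ≠ ⊥ → ∀ (ρH
    : Literature.MathematicalPhysics.QuantumFieldTheory.LatticeRep H) (r :
    Literature.MathematicalPhysics.QuantumFieldTheory.LatticeRep G), ∀ (a β : ℝ) (cls : ∀ S : ℕ,
    Literature.MathematicalPhysics.QuantumFieldTheory.GaugeConfig 4 (2 * S + 1) H → Option ({p : Fin 4 × Fin 4 // p.1
    < p.2} → ↥π.ker)), (∀ S : ℕ, ((∀ o : Option ({p : Fin 4 × Fin 4 // p.1 < p.2} → ↥π.ker), MeasurableSet ((cls S) ⁻¹'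
    {o})) ∧ (∀ V : Literature.MathematicalPhysics.QuantumFieldTheory.GaugeConfig 4 (2 * S + 1) H, (cls S) V = none ↔
    (S < 64 ∨ ∃ (k : ℕ) (ch : Fin (k + 1) → Literature.MathematicalPhysics.QuantumFieldTheory.Plaquette 4 (2 * S +
    1)), (∀ i, a ≤ (r.N : ℝ) - ((r.ρ.comp π) (Literature.MathematicalPhysics.QuantumFieldTheory.plaquetteHolonomy V
    (ch i).1 (ch i).2.1.1 (ch i).2.1.2)).trace.re) ∧ (∀ i : Fin k, (Finset.univ.sup fun j : Fin 4 => (((ch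
    i.castSucc).1 j - (ch i.succ).1 j).valMinAbs).natAbs) ≤ 3) ∧ S ≤ 16 * (Finset.univ.sup fun j : Fin 4 => (((ch 0).1
    j - (ch (Fin.last k)).1 j).valMinAbs).natAbs))) ∧ (∀ (ε : Literature.MathematicalPhysics.QuantumFieldTheory.Edge 4
    (2 * S + 1) → ↥π.ker) (V : Literature.MathematicalPhysics.QuantumFieldTheory.GaugeConfig 4 (2 * S + 1) H), (cls S)
    (fun e => ((ε e : ↥π.ker) : H) * V e) = (cls S) V) ∧ (∀ (g :
    Literature.MathematicalPhysics.QuantumFieldTheory.Site 4 (2 * S + 1) → H) (V :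
    Literature.MathematicalPhysics.QuantumFieldTheory.GaugeConfig 4 (2 * S + 1) H), (cls S)
    (Literature.MathematicalPhysics.QuantumFieldTheory.gaugeTransform g V) = (cls S) V) ∧ (∀ (v :
    Literature.MathematicalPhysics.QuantumFieldTheory.Site 4 (2 * S + 1)) (V :
    Literature.MathematicalPhysics.QuantumFieldTheory.GaugeConfig 4 (2 * S + 1) H), (cls S) (fun e => V (e.1 + v,
    e.2)) = (cls S) V) ∧ (∀ (V V' : Literature.MathematicalPhysics.QuantumFieldTheory.GaugeConfig 4 (2 * S + 1) H) (x₀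
    : Literature.MathematicalPhysics.QuantumFieldTheory.Site 4 (2 * S + 1)), (∀ e :
    Literature.MathematicalPhysics.QuantumFieldTheory.Edge 4 (2 * S + 1), S < 16 * (Finset.univ.sup fun j : Fin 4 =>
    ((e.1 j - x₀ j).valMinAbs).natAbs) → V e = V' e) → (cls S) V ≠ none → (cls S) V' ≠ none → (cls S) V = (cls S) V')
    ∧ (∀ (z : {p : Fin 4 × Fin 4 // p.1 < p.2} → ↥π.ker) (ε : Literature.MathematicalPhysics.QuantumFieldTheory.Edge 4
    (2 * S + 1) → ↥π.ker) (V : Literature.MathematicalPhysics.QuantumFieldTheory.GaugeConfig 4 (2 * S + 1) H), (∀ p :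
    Literature.MathematicalPhysics.QuantumFieldTheory.Plaquette 4 (2 * S + 1), (∀ k' : H, k' ∈ π.ker → k' ≠ ((if p.1
    p.2.1.1 = 0 ∧ p.1 p.2.1.2 = 0 then ((z p.2 : ↥π.ker) : H) else (1 : H)) *
    Literature.MathematicalPhysics.QuantumFieldTheory.plaquetteHolonomy (fun e => ((ε e : ↥π.ker) : H)) p.1 p.2.1.1
    p.2.1.2) → (ρH.ρ (k'⁻¹ * Literature.MathematicalPhysics.QuantumFieldTheory.plaquetteHolonomy V p.1 p.2.1.1
    p.2.1.2)).trace.re < (ρH.ρ ((((if p.1 p.2.1.1 = 0 ∧ p.1 p.2.1.2 = 0 then ((z p.2 : ↥π.ker) : H) else (1 : H)) *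
    Literature.MathematicalPhysics.QuantumFieldTheory.plaquetteHolonomy (fun e => ((ε e : ↥π.ker) : H)) p.1 p.2.1.1
    p.2.1.2))⁻¹ * Literature.MathematicalPhysics.QuantumFieldTheory.plaquetteHolonomy V p.1 p.2.1.1
    p.2.1.2)).trace.re)) → (cls S) V = none ∨ (cls S) V = some z) ∧ (∀ q : {p : Fin 4 × Fin 4 // p.1 < p.2}, q.1.1 ≠ 0
    → ∃ (σ : Equiv.Perm (Fin 4)) (Ψ : ({p : Fin 4 × Fin 4 // p.1 < p.2} → ↥π.ker) → ({p : Fin 4 × Fin 4 // p.1 < p.2}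
    → ↥π.ker)), Function.Injective Ψ ∧ (∀ V : Literature.MathematicalPhysics.QuantumFieldTheory.GaugeConfig 4 (2 * S +
    1) H, (cls S) (Literature.MathematicalPhysics.QuantumFieldTheory.configPerm σ V) = ((cls S) V).map Ψ) ∧ (∀ z w :
    {p : Fin 4 × Fin 4 // p.1 < p.2} → ↥π.ker, (∀ q' : {p : Fin 4 × Fin 4 // p.1 < p.2}, q' ≠ q → z q' = w q') → ∀ q''
    : {p : Fin 4 × Fin 4 // p.1 < p.2}, q''.1.1 ≠ 0 → Ψ z q'' = Ψ w q'')))) → (∃ c : ℝ, 0 < c ∧ ∃ C : ℝ, ∀ S : ℕ,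
    ((Literature.MathematicalPhysics.QuantumFieldTheory.wilsonMeasure (r.ρ.comp π) β : MeasureTheory.Measure
    (Literature.MathematicalPhysics.QuantumFieldTheory.GaugeConfig 4 (2 * S + 1) H)) ((cls S) ⁻¹' {none})).toReal ≤ C
    * Real.exp (-(c * S))) → (∃ m : ℝ, 0 < m ∧ ∀ A B : Literature.MathematicalPhysics.QuantumFieldTheory.YMSpecies G,
    ∃ C : ℝ, ∀ (S n : ℕ) (z : {p : Fin 4 × Fin 4 // p.1 < p.2} → ↥π.ker), n ≤ S → |(∫ V in ((cls S) ⁻¹' {some z}), A.F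
    (fun e => π (Literature.MathematicalPhysics.QuantumLattice.torusLift (2 * S + 1) V e)) * B.F (fun e => π
    (Literature.MathematicalPhysics.QuantumLattice.configShift (-Pi.single 0 (n : ℤ))
    (Literature.MathematicalPhysics.QuantumLattice.torusLift (2 * S + 1) V) e))
    ∂(Literature.MathematicalPhysics.QuantumFieldTheory.wilsonMeasure (r.ρ.comp π) β : MeasureTheory.Measure
    (Literature.MathematicalPhysics.QuantumFieldTheory.GaugeConfig 4 (2 * S + 1) H))) -
    (((Literature.MathematicalPhysics.QuantumFieldTheory.wilsonMeasure (r.ρ.comp π) β : MeasureTheory.Measure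
    (Literature.MathematicalPhysics.QuantumFieldTheory.GaugeConfig 4 (2 * S + 1) H)) ((cls S) ⁻¹' {some z})).toReal)⁻¹
    * (∫ V in ((cls S) ⁻¹' {some z}), A.F (fun e => π (Literature.MathematicalPhysics.QuantumLattice.torusLift (2 * S
    + 1) V e)) ∂(Literature.MathematicalPhysics.QuantumFieldTheory.wilsonMeasure (r.ρ.comp π) β :
    MeasureTheory.Measure (Literature.MathematicalPhysics.QuantumFieldTheory.GaugeConfig 4 (2 * S + 1) H))) * (∫ V in
    ((cls S) ⁻¹' {some z}), B.F (fun e => π (Literature.MathematicalPhysics.QuantumLattice.configShift (-Pi.single 0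
    (n : ℤ)) (Literature.MathematicalPhysics.QuantumLattice.torusLift (2 * S + 1) V) e))
    ∂(Literature.MathematicalPhysics.QuantumFieldTheory.wilsonMeasure (r.ρ.comp π) β : MeasureTheory.Measure
    (Literature.MathematicalPhysics.QuantumFieldTheory.GaugeConfig 4 (2 * S + 1) H)))| ≤ C * Real.exp (-(m * n)) *
    ((Literature.MathematicalPhysics.QuantumFieldTheory.wilsonMeasure (r.ρ.comp π) β : MeasureTheory.Measure
    (Literature.MathematicalPhysics.QuantumFieldTheory.GaugeConfig 4 (2 * S + 1) H)) ((cls S) ⁻¹' {some z})).toReal) →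
    (∃ μ : ℝ, 0 < μ ∧ ∃ C : ℝ, ∀ (S : ℕ) (z w : {p : Fin 4 × Fin 4 // p.1 < p.2} → ↥π.ker), (∀ q : {p : Fin 4 × Fin 4
    // p.1 < p.2}, q.1.1 ≠ 0 → z q = w q) → |((Literature.MathematicalPhysics.QuantumFieldTheory.wilsonMeasure
    (r.ρ.comp π) β : MeasureTheory.Measure (Literature.MathematicalPhysics.QuantumFieldTheory.GaugeConfig 4 (2 * S +
    1) H)) ((cls S) ⁻¹' {some z})).toReal - ((Literature.MathematicalPhysics.QuantumFieldTheory.wilsonMeasure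
    (r.ρ.comp π) β : MeasureTheory.Measure (Literature.MathematicalPhysics.QuantumFieldTheory.GaugeConfig 4 (2 * S +
    1) H)) ((cls S) ⁻¹' {some w})).toReal| ≤ C * Real.exp (-(μ * (2 * (S : ℝ) + 1))) *
    ((Literature.MathematicalPhysics.QuantumFieldTheory.wilsonMeasure (r.ρ.comp π) β : MeasureTheory.Measure
    (Literature.MathematicalPhysics.QuantumFieldTheory.GaugeConfig 4 (2 * S + 1) H)) ((cls S) ⁻¹' {some w})).toReal) →
    (∃ μ : ℝ, 0 < μ ∧ ∀ A : Literature.MathematicalPhysics.QuantumFieldTheory.YMSpecies G, ∃ C : ℝ, ∀ (S : ℕ) (z w :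
    {p : Fin 4 × Fin 4 // p.1 < p.2} → ↥π.ker), (∀ q : {p : Fin 4 × Fin 4 // p.1 < p.2}, q.1.1 ≠ 0 → z q = w q) → |((Literature.MathematicalPhysics.QuantumFieldTheory.wilsonMeasure
    (r.ρ.comp π) β : MeasureTheory.Measure (Literature.MathematicalPhysics.QuantumFieldTheory.GaugeConfig 4 (2 * S +
    1) H)) ((cls S) ⁻¹' {some w})).toReal * (∫ V in ((cls S) ⁻¹' {some z}), A.F (fun e => π
    (Literature.MathematicalPhysics.QuantumLattice.torusLift (2 * S + 1) V e))
    ∂(Literature.MathematicalPhysics.QuantumFieldTheory.wilsonMeasure (r.ρ.comp π) β : MeasureTheory.Measure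
    (Literature.MathematicalPhysics.QuantumFieldTheory.GaugeConfig 4 (2 * S + 1) H))) -
    ((Literature.MathematicalPhysics.QuantumFieldTheory.wilsonMeasure (r.ρ.comp π) β : MeasureTheory.Measure
    (Literature.MathematicalPhysics.QuantumFieldTheory.GaugeConfig 4 (2 * S + 1) H)) ((cls S) ⁻¹' {some z})).toReal *
    (∫ V in ((cls S) ⁻¹' {some w}), A.F (fun e => π (Literature.MathematicalPhysics.QuantumLattice.torusLift (2 * S +
    1) V e)) ∂(Literature.MathematicalPhysics.QuantumFieldTheory.wilsonMeasure (r.ρ.comp π) β : MeasureTheory.Measure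
    (Literature.MathematicalPhysics.QuantumFieldTheory.GaugeConfig 4 (2 * S + 1) H)))| ≤ C * Real.exp (-(μ * (2 * (S :
    ℝ) + 1))) * ((Literature.MathematicalPhysics.QuantumFieldTheory.wilsonMeasure (r.ρ.comp π) β :
    MeasureTheory.Measure (Literature.MathematicalPhysics.QuantumFieldTheory.GaugeConfig 4 (2 * S + 1) H)) ((cls S) ⁻¹'
    {some z})).toReal * ((Literature.MathematicalPhysics.QuantumFieldTheory.wilsonMeasure (r.ρ.comp π) β :
    MeasureTheory.Measure (Literature.MathematicalPhysics.QuantumFieldTheory.GaugeConfig 4 (2 * S + 1) H)) ((cls S) ⁻¹'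
    {some w})).toReal) → (∃ m : ℝ, 0 < m ∧ ∃ S₁ : ℕ, ∀ A B :
    Literature.MathematicalPhysics.QuantumFieldTheory.YMSpecies G, ∃ C : ℝ, ∀ S n : ℕ, S₁ ≤ S → n ≤ S → |Literature.MathematicalPhysics.QuantumFieldTheory.latticeConnectedCorr
    (r.ρ.comp π) β (2 * S + 1) (fun V => A.F (fun e => π (V e))) (fun V => B.F (fun e => π (V e))) n| ≤ C * Real.exp
    (-(m * n))) := by
  intro G _ _ _ _ _ _ _ H _ _ _ _ _ _ _ _ π hπc _ _ hfin _ _ r _ β cls hI hbad hpsc hequi heblind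
  haveI : Fintype ↥π.ker := @Fintype.ofFinite _ hfin.to_subtype
  exact mix_core π hπc (r.ρ.comp π) (r.continuous.comp hπc) β cls
    (fun S => (Literature.MathematicalPhysics.QuantumFieldTheory.wilsonMeasure (r.ρ.comp π) β :
      MeasureTheory.Measure (Literature.MathematicalPhysics.QuantumFieldTheory.GaugeConfig 4 (2 * S + 1) H)))
    (fun _ => rfl) (fun S => (hI S).1) (fun S => (hI S).2.2.2.2.1) (fun S => (hI S).2.2.2.2.2.2.2) hbad
    hpsc hequi heblind


end Summit.QuantumFields.YangMills.Theorems.NonSimplyConnectedLatticeGap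

end
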